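import Summits.RiemannHypothesis.RiemannHypothesis.Theorems.SoloInformedQuasiWeilSplit
import Literature.NumberTheory.LFunctions.VinogradovZetaSumEstimate
import Literature.NumberTheory.LFunctions.VinogradovKorobovDirichlet

/-!
# Exponential slack in Weil's criterion, VIII: what the Vinogradov–Korobov region buys

Solo programme `solo-RiemannHypothesis-informed`, session 15 (T60, part 2 of 2). Parts I–VI
showed that the Riemann Hypothesis, and more generally a zero-free strip of width `Θ`, is
EQUIVALENT to an exponential rate in Weil's functional on windows `[-a, a]`:
`Re W(g ∗ g̃) ≥ -C_κ e^{κa} ‖g‖²_{H¹}` for all `κ > Θ` (`riemannHypothesis_iff_weilQuadratic_width`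
family; `Θ = 0` is RH). Unconditionally only `Θ = 1` was available (`0 < Re ρ < 1`), i.e. the
rate `e^{a}`. This file computes, inside the kernel, what the strongest zero-free region of the
tree buys on this axis:

* `exists_zeroForm_re_ge_split` — the height-split Sobolev bound: a width `Θ` imposed only on
  the zeros with `|Im ρ| ≤ H` gives `Re Q(g) ≥ -C (1+a)³ (e^{Θa} + e^{a}/(1+H²)) ‖g‖²_{H²}`;
* `eventually_abs_re_sub_half_le_vk` — the tree's UNCONDITIONAL Vinogradov–Korobov region
  (`VKZeta.exists_hasVKZeroFreeRegion`, from the formalised Vinogradov mean value theorem), in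
  the form: for `η > 2/3` and large `X`, every non-trivial zero with `|Im ρ| ≤ 3X` has
  `|Re ρ - 1/2| ≤ 1/2 - (log X)^{-η}`;
* `eventually_weilQuadratic_re_ge_exp_sub_rpow` — choosing `X = exp(a^θ)`, for every
  `0 < θ < 3/5` and all large `a`, every test `g` on `[-a, a]` satisfies
  `Re W(g ∗ g̃) ≥ -e^{a - a^θ} (‖g‖₂² + ‖g'‖₂² + ‖g''‖₂²)`, UNCONDITIONALLY.

Reading (the census point made kernel-exact): the best known zero-free region improves the
trivial rate `e^{a}` only by the sub-exponential factor `e^{-a^θ}`, `θ < 3/5`; the exponential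
TYPE stays `κ = 1`, whereas by part I any rate `e^{κa}` with a fixed `κ < 1` is already a
quasi-Riemann hypothesis (no zeros with `Re ρ > (1+κ)/2`). The distance from the theorem of this
file to RH is exactly the distance from `a - a^{3/5}` to `εa` in the exponent.
-/

noncomputable section

open Complex Filter Set MeasureTheory
open scoped Real Topology ComplexConjugate

namespace Summit.RiemannHypothesis.RiemannHypothesis.Theorems

open Literature.NumberTheory.LFunctions Literature.NumberTheory.LFunctions.WeilConverse

variable {g : ℝ → ℂ}

/-- **The height-split Sobolev bound on the zero side.** There is an absolute `C ≥ 0` such that: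
if `0 < Θ ≤ 1`, `H ≥ 0`, and every non-trivial zero with `|Im ρ| ≤ H` has `|Re ρ - 1/2| ≤ Θ/2`,
then for every `a > 0` and every test `g` on `[-a, a]`
`Re Q(g) ≥ -C (1+a)³ (e^{Θa} + e^{a}/(1+H²)) (‖g‖₂² + ‖g'‖₂² + ‖g''‖₂²)`, where
`Q(g) = Σ_ρ m(ρ) ĝ(ρ) conj ĝ(1-ρ̄)` is the zero side (`zeroForm`). The zeros below `H` are handled
by `sum_order_mul_norm_sq_le_of_width`, those above by `sum_order_mul_norm_sq_le_of_height`; the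
passage from partial sums to the sum over all zeros is that of part VI. [folklore] -/
theorem exists_zeroForm_re_ge_split :
    ∃ C : ℝ, 0 ≤ C ∧ ∀ (Θ H : ℝ), 0 < Θ → Θ ≤ 1 → 0 ≤ H →
      (∀ ρ ∈ ZetaZeros.riemannZetaNontrivialZeros, |ρ.im| ≤ H → |ρ.re - 1 / 2| ≤ Θ / 2) →
      ∀ a : ℝ, 0 < a → ∀ g : ℝ → ℂ, IsWeilTest g → tsupport g ⊆ Icc (-a) a →
        -(C * (1 + a) ^ 3 * (Real.exp (Θ * a) + Real.exp a / (1 + H ^ 2))) *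
            (weilNorm2Sq g + weilNorm2Sq (deriv g) + weilNorm2Sq (deriv (deriv g))) ≤
          (zeroForm g).re := by
  classical
  obtain ⟨d, hd0, hd⟩ := exists_weighted_localCount
  refine ⟨12 * π * d, by positivity, fun Θ H hΘ hΘ1 hH hzero a ha g hg hsupp ↦ ?_⟩
  set N : ℝ := weilNorm2Sq g + weilNorm2Sq (deriv g) + weilNorm2Sq (deriv (deriv g)) with hN
  have hn0 : 0 ≤ weilNorm2Sq g := integral_nonneg fun _ ↦ by positivity
  have hn1 : 0 ≤ weilNorm2Sq (deriv g) := integral_nonneg fun _ ↦ by positivity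
  have hn2 : 0 ≤ weilNorm2Sq (deriv (deriv g)) := integral_nonneg fun _ ↦ by positivity
  rw [zeroForm, Complex.re_tsum (summable_pairCoeff hg)]
  set m : ZetaZeros.riemannZetaNontrivialZeros → ℝ :=
    fun ρ ↦ (riemannZetaZeroOrder (ρ : ℂ) : ℝ) with hm
  have hm0 : ∀ ρ, 0 ≤ m ρ := fun ρ ↦ Int.cast_nonneg (by
    have := ZetaZeros.riemannZetaNontrivialZeros.one_le_order ρ.2
    omega)
  set E : ZetaZeros.riemannZetaNontrivialZeros → ℝ := fun ρ ↦
    if (ρ : ℂ).re = 1 / 2 then 0 else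
      m ρ / 2 * (‖weilMellin g ρ‖ ^ 2 + ‖weilMellin g (1 - conj (ρ : ℂ))‖ ^ 2) with hE
  have hE0 : ∀ ρ, 0 ≤ E ρ := by
    intro ρ
    by_cases h : (ρ : ℂ).re = 1 / 2
    · simp [hE, h]
    · simp only [hE, h, if_false]
      exact mul_nonneg (div_nonneg (hm0 ρ) zero_le_two) (by positivity)
  -- pointwise: `-E ρ ≤ Re (m(ρ) ĝ(ρ) conj ĝ(1-ρ̄))` (on the line the term is `m|ĝ(ρ)|² ≥ 0`)
  have hptE : ∀ ρ, -E ρ ≤ ((riemannZetaZeroOrder (ρ : ℂ) : ℂ) * pairCoeff g ρ).re := by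
    intro ρ
    by_cases hρ : (ρ : ℂ).re = 1 / 2
    · simp only [hE, hρ, if_true, neg_zero]
      exact re_order_mul_pairCoeff_nonneg_of_re_eq_half g hρ
    · simp only [hE, hρ, if_false]
      have h1 : -‖(riemannZetaZeroOrder (ρ : ℂ) : ℂ) * pairCoeff g ρ‖ ≤
          ((riemannZetaZeroOrder (ρ : ℂ) : ℂ) * pairCoeff g ρ).re :=
        (abs_le.1 (Complex.abs_re_le_norm _)).1
      refine le_trans ?_ h1
      rw [neg_le_neg_iff, norm_mul, Complex.norm_intCast, abs_of_nonneg (hm0 ρ), pairCoeff,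
        norm_mul, Complex.norm_conj]
      have hu := norm_nonneg (weilMellin g ρ)
      have hv := norm_nonneg (weilMellin g (1 - conj (ρ : ℂ)))
      have h2 : ‖weilMellin g ρ‖ * ‖weilMellin g (1 - conj (ρ : ℂ))‖ ≤
          (‖weilMellin g ρ‖ ^ 2 + ‖weilMellin g (1 - conj (ρ : ℂ))‖ ^ 2) / 2 := by
        nlinarith [sq_nonneg (‖weilMellin g ρ‖ - ‖weilMellin g (1 - conj (ρ : ℂ))‖)]
      calc (riemannZetaZeroOrder (ρ : ℂ) : ℝ) *
            (‖weilMellin g ρ‖ * ‖weilMellin g (1 - conj (ρ : ℂ))‖)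
          ≤ (riemannZetaZeroOrder (ρ : ℂ) : ℝ) *
              ((‖weilMellin g ρ‖ ^ 2 + ‖weilMellin g (1 - conj (ρ : ℂ))‖ ^ 2) / 2) :=
            mul_le_mul_of_nonneg_left h2 (hm0 ρ)
        _ = m ρ / 2 * (‖weilMellin g ρ‖ ^ 2 + ‖weilMellin g (1 - conj (ρ : ℂ))‖ ^ 2) := by
            rw [hm]; ring
  set B : ℝ := 12 * π * d * (1 + a) ^ 3 * (Real.exp (Θ * a) + Real.exp a / (1 + H ^ 2)) * N
    with hB
  -- uniform bound on the partial sums of `E`: split off-line zeros at height `H`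
  have hpartial : ∀ T : Finset ZetaZeros.riemannZetaNontrivialZeros, ∑ ρ ∈ T, E ρ ≤ B := by
    intro T
    set T' := T.filter (fun ρ : ZetaZeros.riemannZetaNontrivialZeros ↦ (ρ : ℂ).re ≠ 1 / 2)
      with hT'
    have hsumE : ∑ ρ ∈ T, E ρ = ∑ ρ ∈ T',
        m ρ / 2 * (‖weilMellin g ρ‖ ^ 2 + ‖weilMellin g (1 - conj (ρ : ℂ))‖ ^ 2) := by
      rw [hT', Finset.sum_filter]
      refine Finset.sum_congr rfl fun ρ _ ↦ ?_
      by_cases h : (ρ : ℂ).re = 1 / 2 <;> simp [hE, h]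
    set Tlo := T'.filter (fun ρ : ZetaZeros.riemannZetaNontrivialZeros ↦ |(ρ : ℂ).im| ≤ H)
      with hTlo
    set Thi := T'.filter (fun ρ : ZetaZeros.riemannZetaNontrivialZeros ↦ ¬|(ρ : ℂ).im| ≤ H)
      with hThi
    have hlo : ∀ ρ ∈ Tlo, |(ρ : ℂ).re - 1 / 2| ≤ Θ / 2 := fun ρ hρ ↦
      hzero _ ρ.2 (Finset.mem_filter.1 hρ).2
    have hhi : ∀ ρ ∈ Thi, H ≤ |(ρ : ℂ).im| := fun ρ hρ ↦
      (not_le.1 (Finset.mem_filter.1 hρ).2).le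
    have h1 := sum_order_mul_norm_sq_le_of_width hg ha hsupp hd hΘ Tlo hlo
    have h2 := sum_order_mul_norm_sq_le_of_height hg ha hsupp hd hH Thi hhi
    have hhalf : ∀ S : Finset ZetaZeros.riemannZetaNontrivialZeros,
        ∑ ρ ∈ S, m ρ / 2 * (‖weilMellin g ρ‖ ^ 2 + ‖weilMellin g (1 - conj (ρ : ℂ))‖ ^ 2) =
          (1 / 2) * ∑ ρ ∈ S,
            m ρ * (‖weilMellin g ρ‖ ^ 2 + ‖weilMellin g (1 - conj (ρ : ℂ))‖ ^ 2) := by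
      intro S
      rw [Finset.mul_sum]
      exact Finset.sum_congr rfl fun ρ _ ↦ by ring
    -- polynomial slack: `(1+Θa)(3+a²), (1+a)(3+a²) ≤ 3(1+a)³`
    have hp1 : (1 + Θ * a) * (3 + a ^ 2) ≤ 3 * (1 + a) ^ 3 := by
      have : Θ * a ≤ a := by nlinarith
      nlinarith
    have hp2 : (1 + a) * (3 + a ^ 2) ≤ 3 * (1 + a) ^ 3 := by nlinarith
    have hN1 : weilNorm2Sq g + weilNorm2Sq (deriv g) ≤ N := by rw [hN]; linarith
    have hN2 : weilNorm2Sq g + 2 * weilNorm2Sq (deriv g) + weilNorm2Sq (deriv (deriv g)) ≤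
        2 * N := by rw [hN]; linarith
    have hlow : 4 * π * d * (1 + Θ * a) * (3 + a ^ 2) * Real.exp (Θ * a) *
        (weilNorm2Sq g + weilNorm2Sq (deriv g)) ≤
          4 * π * d * Real.exp (Θ * a) * (3 * (1 + a) ^ 3 * N) := by
      have h := mul_le_mul hp1 hN1 (by positivity) (by positivity)
      calc 4 * π * d * (1 + Θ * a) * (3 + a ^ 2) * Real.exp (Θ * a) *
            (weilNorm2Sq g + weilNorm2Sq (deriv g))
          = 4 * π * d * Real.exp (Θ * a) *
              ((1 + Θ * a) * (3 + a ^ 2) * (weilNorm2Sq g + weilNorm2Sq (deriv g))) := by ring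
        _ ≤ _ := mul_le_mul_of_nonneg_left h (by positivity)
    have hhigh : 4 * π * (d / (1 + H ^ 2)) * (1 + a) * (3 + a ^ 2) * Real.exp a *
        (weilNorm2Sq g + 2 * weilNorm2Sq (deriv g) + weilNorm2Sq (deriv (deriv g))) ≤
          4 * π * (d / (1 + H ^ 2)) * Real.exp a * (3 * (1 + a) ^ 3 * (2 * N)) := by
      have h := mul_le_mul hp2 hN2 (by positivity) (by positivity)
      calc 4 * π * (d / (1 + H ^ 2)) * (1 + a) * (3 + a ^ 2) * Real.exp a *
            (weilNorm2Sq g + 2 * weilNorm2Sq (deriv g) + weilNorm2Sq (deriv (deriv g)))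
          = 4 * π * (d / (1 + H ^ 2)) * Real.exp a * ((1 + a) * (3 + a ^ 2) *
              (weilNorm2Sq g + 2 * weilNorm2Sq (deriv g) + weilNorm2Sq (deriv (deriv g)))) :=
            by ring
        _ ≤ _ := mul_le_mul_of_nonneg_left h (by positivity)
    have hx : 0 ≤ π * d * (1 + a) ^ 3 * Real.exp (Θ * a) * N := by positivity
    have heq : (1 / 2) * (4 * π * d * Real.exp (Θ * a) * (3 * (1 + a) ^ 3 * N)) +
        (1 / 2) * (4 * π * (d / (1 + H ^ 2)) * Real.exp a * (3 * (1 + a) ^ 3 * (2 * N))) +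
          6 * π * d * (1 + a) ^ 3 * Real.exp (Θ * a) * N = B := by
      rw [hB]; ring
    calc ∑ ρ ∈ T, E ρ = ∑ ρ ∈ T',
          m ρ / 2 * (‖weilMellin g ρ‖ ^ 2 + ‖weilMellin g (1 - conj (ρ : ℂ))‖ ^ 2) := hsumE
      _ = (1 / 2) * ∑ ρ ∈ Tlo,
              m ρ * (‖weilMellin g ρ‖ ^ 2 + ‖weilMellin g (1 - conj (ρ : ℂ))‖ ^ 2) +
            (1 / 2) * ∑ ρ ∈ Thi,
              m ρ * (‖weilMellin g ρ‖ ^ 2 + ‖weilMellin g (1 - conj (ρ : ℂ))‖ ^ 2) := by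
          rw [← Finset.sum_filter_add_sum_filter_not T'
            (fun ρ : ZetaZeros.riemannZetaNontrivialZeros ↦ |(ρ : ℂ).im| ≤ H), hhalf, hhalf]
      _ ≤ (1 / 2) * (4 * π * d * Real.exp (Θ * a) * (3 * (1 + a) ^ 3 * N)) +
            (1 / 2) * (4 * π * (d / (1 + H ^ 2)) * Real.exp a * (3 * (1 + a) ^ 3 * (2 * N))) :=
          add_le_add (mul_le_mul_of_nonneg_left (h1.trans hlow) (by norm_num))
            (mul_le_mul_of_nonneg_left (h2.trans hhigh) (by norm_num))
      _ ≤ B := by linarith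
  have hEs : Summable E := summable_of_sum_le hE0 hpartial
  have hEt : ∑' ρ, E ρ ≤ B := hEs.tsum_le_of_sum_le hpartial
  have hsum : Summable fun ρ : ZetaZeros.riemannZetaNontrivialZeros ↦
      ((riemannZetaZeroOrder (ρ : ℂ) : ℂ) * pairCoeff g ρ).re :=
    (Complex.hasSum_re (summable_pairCoeff hg).hasSum).summable
  have hge : -B ≤ ∑' ρ : ZetaZeros.riemannZetaNontrivialZeros,
      ((riemannZetaZeroOrder (ρ : ℂ) : ℂ) * pairCoeff g ρ).re := by
    calc -B ≤ -∑' ρ, E ρ := neg_le_neg hEt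
      _ = ∑' ρ, -E ρ := tsum_neg.symm
      _ ≤ _ := hEs.neg.tsum_le_tsum hptE hsum
  calc -(12 * π * d * (1 + a) ^ 3 * (Real.exp (Θ * a) + Real.exp a / (1 + H ^ 2))) * N
      = -B := by rw [hB]; ring
    _ ≤ _ := hge

/-- **Vinogradov–Korobov for the non-trivial zeros, on both sides of the critical line.** For
`η > 2/3` and all large `X`, every non-trivial zero `ρ` with `|Im ρ| ≤ 3X` satisfies
`|Re ρ - 1/2| ≤ 1/2 - (log X)^{-η}`. Input: the tree's UNCONDITIONAL region
`VKZeta.exists_hasVKZeroFreeRegion` (proved there from the formalised Vinogradov mean value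
theorem) through `VKDirichlet.eventually_riemannZeta₁_ne_zero_of_vk`, applied to `ρ` and to its
reflection `1 - ρ̄`. [cite: Ivic1985, Theorem 6.1] -/
theorem eventually_abs_re_sub_half_le_vk {η : ℝ} (hη : 2 / 3 < η) :
    ∀ᶠ X : ℝ in atTop, ∀ ρ ∈ ZetaZeros.riemannZetaNontrivialZeros, |ρ.im| ≤ 3 * X →
      |ρ.re - 1 / 2| ≤ 1 / 2 - Real.log X ^ (-η) := by
  obtain ⟨c, hc, hVK⟩ := VKZeta.exists_hasVKZeroFreeRegion
  filter_upwards [VKDirichlet.eventually_riemannZeta₁_ne_zero_of_vk hc hVK hη] with X hX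
  intro ρ hρ hρX
  have hρ' := ZetaZeros.riemannZetaNontrivialZeros.one_sub_conj_mem hρ
  have h1 : ρ.re < 1 - Real.log X ^ (-η) := by
    by_contra h
    exact hX ρ hρX (not_lt.1 h)
      ((riemannZeta₁_eq_zero_iff (ZetaZeros.riemannZetaNontrivialZeros.ne_one hρ)).2
        (ZetaZeros.riemannZetaNontrivialZeros.zeta_eq_zero hρ))
  have h2 : (1 - conj ρ).re < 1 - Real.log X ^ (-η) := by
    by_contra h
    refine hX (1 - conj ρ) (by simpa using hρX) (not_lt.1 h)
      ((riemannZeta₁_eq_zero_iff (ZetaZeros.riemannZetaNontrivialZeros.ne_one hρ')).2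
        (ZetaZeros.riemannZetaNontrivialZeros.zeta_eq_zero hρ'))
  simp only [sub_re, one_re, conj_re] at h2
  rw [abs_le]
  constructor <;> linarith

/-- For `θ > 0` and `K ≥ 0`: `K (1+a)³ ≤ exp(a^θ)` for all large `a` (three logarithms lose to any
power). [folklore] -/
theorem eventually_mul_one_add_pow_three_le_exp_rpow {θ : ℝ} (hθ : 0 < θ) {K : ℝ} (hK : 0 ≤ K) :
    ∀ᶠ a : ℝ in atTop, K * (1 + a) ^ 3 ≤ Real.exp (a ^ θ) := by
  have hK1 : 0 < K + 1 := by linarith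
  filter_upwards [(isLittleO_log_rpow_atTop hθ).bound (show (0 : ℝ) < 1 / 8 by norm_num),
    (tendsto_rpow_atTop hθ).eventually_ge_atTop (8 * (Real.log (K + 1) + 3 * Real.log 2)),
    eventually_ge_atTop (1 : ℝ)] with a hlog hbig ha1
  have ha : 0 < a := by linarith
  have hθa : 0 ≤ a ^ θ := Real.rpow_nonneg ha.le θ
  rw [Real.norm_of_nonneg (Real.log_nonneg ha1), Real.norm_of_nonneg hθa] at hlog
  have h1a : Real.log (1 + a) ≤ Real.log 2 + Real.log a := by
    rw [← Real.log_mul (by norm_num) ha.ne']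
    exact Real.log_le_log (by linarith) (by linarith)
  have hle : Real.log ((K + 1) * (1 + a) ^ 3) ≤ a ^ θ := by
    rw [Real.log_mul hK1.ne' (by positivity), Real.log_pow, Nat.cast_ofNat]
    linarith
  calc K * (1 + a) ^ 3 ≤ (K + 1) * (1 + a) ^ 3 := by gcongr; linarith
    _ = Real.exp (Real.log ((K + 1) * (1 + a) ^ 3)) := (Real.exp_log (by positivity)).symm
    _ ≤ Real.exp (a ^ θ) := Real.exp_le_exp.2 hle

/-- **What Vinogradov–Korobov buys in Weil units (zero side).** For every `0 < θ < 3/5` and all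
large `a`: every test `g` on `[-a, a]` has
`Re Σ_ρ m(ρ) ĝ(ρ) conj ĝ(1-ρ̄) ≥ -e^{a - a^θ} (‖g‖₂² + ‖g'‖₂² + ‖g''‖₂²)`, unconditionally.
Proof: `exists_zeroForm_re_ge_split` with `H = 3X`, `X = exp(a^θ)` and the VK width
`Θ = 1 - 2a^{θ-1}` below `H` (`eventually_abs_re_sub_half_le_vk` with `η = (1-θ)/θ > 2/3`):
both `e^{Θa} = e^{a-2a^θ}` and `e^{a}/(1+9X²) ≤ e^{a-2a^θ}`, and `2C(1+a)³ ≤ e^{a^θ}`.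
[cite: Ivic1985, Theorem 6.1] -/
theorem eventually_zeroForm_re_ge_exp_sub_rpow {θ : ℝ} (hθ0 : 0 < θ) (hθ : θ < 3 / 5) :
    ∀ᶠ a : ℝ in atTop, ∀ g : ℝ → ℂ, IsWeilTest g → tsupport g ⊆ Icc (-a) a →
      -Real.exp (a - a ^ θ) *
          (weilNorm2Sq g + weilNorm2Sq (deriv g) + weilNorm2Sq (deriv (deriv g))) ≤
        (zeroForm g).re := by
  obtain ⟨C, hC0, hC⟩ := exists_zeroForm_re_ge_split
  set η : ℝ := (1 - θ) / θ with hη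
  have hη23 : 2 / 3 < η := by rw [hη, lt_div_iff₀ hθ0]; linarith
  obtain ⟨X₀, hX₀⟩ := Filter.eventually_atTop.1 (eventually_abs_re_sub_half_le_vk hη23)
  have hev2 : ∀ᶠ a : ℝ in atTop, a ^ (θ - 1) ≤ 1 / 4 := by
    have ht : Tendsto (fun a : ℝ ↦ a ^ (-(1 - θ))) atTop (𝓝 0) :=
      tendsto_rpow_neg_atTop (by linarith)
    filter_upwards [ht.eventually (Iic_mem_nhds (show (0 : ℝ) < 1 / 4 by norm_num))] with a ha
    have e : -(1 - θ) = θ - 1 := by ring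
    rw [e] at ha
    exact ha
  filter_upwards [(Real.tendsto_exp_atTop.comp (tendsto_rpow_atTop hθ0)).eventually_ge_atTop X₀,
    hev2, eventually_mul_one_add_pow_three_le_exp_rpow hθ0 (show 0 ≤ 2 * C by positivity),
    eventually_ge_atTop (1 : ℝ)] with a h1 h2 h3 ha1
  intro g hg hsupp
  have ha : 0 < a := by linarith
  set X : ℝ := Real.exp (a ^ θ) with hX
  have hXpos : 0 < X := Real.exp_pos _
  -- the VK width at height `3X`, `X = exp(a^θ)`: `(log X)^{-η} = a^{θ-1}`
  have hkey : Real.log X ^ (-η) = a ^ (θ - 1) := by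
    rw [hX, Real.log_exp, ← Real.rpow_mul ha.le]
    congr 1
    rw [hη]; field_simp; ring
  set Θ : ℝ := 1 - 2 * a ^ (θ - 1) with hΘ
  have hΘpos : 0 < Θ := by rw [hΘ]; linarith
  have hΘ1 : Θ ≤ 1 := by
    have : 0 ≤ a ^ (θ - 1) := Real.rpow_nonneg ha.le _
    rw [hΘ]; linarith
  have hzero : ∀ ρ ∈ ZetaZeros.riemannZetaNontrivialZeros, |ρ.im| ≤ 3 * X →
      |ρ.re - 1 / 2| ≤ Θ / 2 := by
    intro ρ hρ hρX
    have := hX₀ X h1 ρ hρ hρX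
    rw [hkey] at this
    rw [hΘ]; linarith
  have hmain := hC Θ (3 * X) hΘpos hΘ1 (by positivity) hzero a ha g hg hsupp
  have hn0 : 0 ≤ weilNorm2Sq g := integral_nonneg fun _ ↦ by positivity
  have hn1 : 0 ≤ weilNorm2Sq (deriv g) := integral_nonneg fun _ ↦ by positivity
  have hn2 : 0 ≤ weilNorm2Sq (deriv (deriv g)) := integral_nonneg fun _ ↦ by positivity
  -- compare the constants: both terms are `≤ e^{a - 2a^θ}`, and `2C(1+a)³ ≤ e^{a^θ}`
  have hΘa : Θ * a = a - 2 * a ^ θ := by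
    rw [hΘ, Real.rpow_sub_one ha.ne' θ]; field_simp
  have hexp2 : Real.exp a / (1 + (3 * X) ^ 2) ≤ Real.exp (a - 2 * a ^ θ) := by
    have hX2 : Real.exp (2 * a ^ θ) = X ^ 2 := by rw [hX, two_mul, Real.exp_add, sq]
    rw [Real.exp_sub, hX2]
    exact div_le_div_of_nonneg_left (Real.exp_pos a).le (by positivity) (by nlinarith)
  have hle : C * (1 + a) ^ 3 * (Real.exp (Θ * a) + Real.exp a / (1 + (3 * X) ^ 2)) ≤
      Real.exp (a - a ^ θ) := by
    calc C * (1 + a) ^ 3 * (Real.exp (Θ * a) + Real.exp a / (1 + (3 * X) ^ 2))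
        ≤ C * (1 + a) ^ 3 * (2 * Real.exp (a - 2 * a ^ θ)) := by
          refine mul_le_mul_of_nonneg_left ?_ (by positivity)
          rw [hΘa]; linarith
      _ = (2 * C * (1 + a) ^ 3) * Real.exp (a - 2 * a ^ θ) := by ring
      _ ≤ Real.exp (a ^ θ) * Real.exp (a - 2 * a ^ θ) :=
          mul_le_mul_of_nonneg_right h3 (Real.exp_pos _).le
      _ = Real.exp (a - a ^ θ) := by rw [← Real.exp_add]; ring_nf
  calc -Real.exp (a - a ^ θ) *
        (weilNorm2Sq g + weilNorm2Sq (deriv g) + weilNorm2Sq (deriv (deriv g)))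
      ≤ -(C * (1 + a) ^ 3 * (Real.exp (Θ * a) + Real.exp a / (1 + (3 * X) ^ 2))) *
          (weilNorm2Sq g + weilNorm2Sq (deriv g) + weilNorm2Sq (deriv (deriv g))) :=
        mul_le_mul_of_nonneg_right (neg_le_neg hle) (by positivity)
    _ ≤ (zeroForm g).re := hmain

/-- **What Vinogradov–Korobov buys in Weil units.** For every `0 < θ < 3/5` there is `a₀` such
that for all `a ≥ a₀` and every test `g` (smooth, support in `[-a, a]`), Weil's functional at
`g ∗ g̃` satisfies, UNCONDITIONALLY,
`Re W(g ∗ g̃) ≥ -e^{a - a^θ} (‖g‖₂² + ‖g'‖₂² + ‖g''‖₂²)`.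
For comparison (parts I, VI): the trivial bound has `e^{a}` (times `(1+a)³`), RH is equivalent to
`e^{κa}` for every `κ > 0`, and any fixed `κ < 1` in the exponent is a quasi-Riemann hypothesis;
the best zero-free region known changes the exponent `a` only by `-a^θ`, `θ < 3/5`.
[cite: Ivic1985, Theorem 6.1] [cite: Weil1952] -/
theorem eventually_weilQuadratic_re_ge_exp_sub_rpow {θ : ℝ} (hθ0 : 0 < θ) (hθ : θ < 3 / 5) :
    ∃ a₀ : ℝ, ∀ a : ℝ, a₀ ≤ a → ∀ g : ℝ → ℂ, IsWeilTest g → tsupport g ⊆ Icc (-a) a →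
      -Real.exp (a - a ^ θ) *
          (weilNorm2Sq g + weilNorm2Sq (deriv g) + weilNorm2Sq (deriv (deriv g))) ≤
        (weilQuadratic g).re := by
  obtain ⟨a₀, h⟩ := Filter.eventually_atTop.1 (eventually_zeroForm_re_ge_exp_sub_rpow hθ0 hθ)
  exact ⟨a₀, fun a ha g hg hs ↦ by
    rw [← combShapeDetection_zeroForm_eq_weilQuadratic hg]; exact h a ha g hg hs⟩

end Summit.RiemannHypothesis.RiemannHypothesis.Theorems
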